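import Literature.NumberTheory.Automorphic.UnitaryGroupHeckeDegreeSplitPlace   -- ★ `card_submodule_codim_one_of_finrank_eq_two` (a plane over `𝔽_q` has `q + 1` lines)
import Mathlib.Algebra.Module.Torsion.Basic
import Mathlib.LinearAlgebra.Quotient.Basic
import Mathlib.LinearAlgebra.Matrix.ToLin
import HarnessLib

/-!
# Stable subgroups of order `q` in a `𝔭`-torsion module of order `q²` over a ring with residue field `𝔽_q`: there are exactly `q + 1`
# ([Shimura 1971] Lemma 3.23 ∕ [Diamond–Shurman] §5.2: the `q + 1` lines of `𝔽_q²`, read for the `𝒪`-stable subgroups of `𝔭⁻¹Λ ∕ Λ`)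

Topic `LinearAlgebra`; namespace `Literature.LinearAlgebra`.  THEOREMS ONLY (no definition, no named fact, no instance, no notation, no `sorry`; Mathlib + ★
`UnitaryGroupHeckeDegreeSplitPlace.card_submodule_codim_one_of_finrank_eq_two`).  Cell `hodgecm-mathlib`, half A line L5, X-LEAF socket `stub_EHECKE`, LA5-plan (g3)
closer organ (O-L) row **(L-c′) «EXHAUSTION BY COUNTING»** (LA5-p01 (g3)): «every `ρ̂₀(𝒪_F)`-stable subgroup of order `q` of `𝔭_{c•w}⁻¹L̂ ∕ L̂` is one of the `q + 1`
Hecke neighbours `H(g)`» follows from the INJECTIVITY of `gK ↦ H(g)` on `K t₁ K ∕ K` (`q + 1` cosets, ★ `natCard_orbit_heckeElementAt_one_uniformizer`) once the TARGET —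
the `𝒪_F`-stable subgroups of order `q` of the `𝔭_{c•w}`-torsion module `𝔭_{c•w}⁻¹L̂ ∕ L̂` of order `q²` — is known to have exactly `q + 1` elements.  This file is that
count, in GENERIC currency (any commutative ring `R`, ideal `𝔭` with `R ⧸ 𝔭` a finite field, any `R`-module `W` killed by `𝔭` with `Nat.card W = (Nat.card (R ⧸ 𝔭))²`),
and the «injective ⇒ bijective» corollary the closer calls.  HC_CM is proved only modulo the 7 printed citations until rung 0 closes; this file is generic and
discharges none of them (`--supports stmt-HodgeConjecture-24832`, count-neutral).

## What is proved
* §1 (any ring, any module): `exists_submodule_toAddSubgroup_eq_iff` — an additive subgroup is stable under the scalars iff it is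
  the underlying subgroup of a (unique) submodule; `natCard_stableAddSubgroup_eq_natCard_submodule` — the two subtypes (with any extra predicate on the carrier
  cardinality) have the same `Nat.card`.
* §2 (vector spaces over a finite field `k`, `q := Nat.card k`) `finite_of_natCard_eq_natCard_pow`, `finrank_eq_of_natCard_eq_natCard_pow` (`Nat.card W = q ^ n ⇒ finrank k W = n`),
  `natCard_submodule_eq_iff_finrank_eq` (`Nat.card Y = q ^ m ↔ finrank k Y = m`), **`natCard_stableAddSubgroup_of_natCard_eq_sq`** — for `Nat.card W = q²`:
  `Nat.card {H : AddSubgroup W // (∀ c x, x ∈ H → c • x ∈ H) ∧ Nat.card H = q} = q + 1`.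
* §3 (modules over a commutative ring `R` killed by an ideal `𝔭` with finite residue FIELD, `q := Nat.card (R ⧸ 𝔭)`) **`natCard_stableAddSubgroup_of_isTorsionBySet`** —
  the same count for `R`-stable subgroups (`R` acts through `R ⧸ 𝔭`, Mathlib `Module.IsTorsionBySet.module`); **`bijective_of_injective_to_stableAddSubgroup`** — an
  injective map into that subtype from a type of `Nat.card = q + 1` is bijective (Mathlib `Function.Injective.bijective_of_nat_card_le`).
* §4 (ED. 2, LATTICE FORM for a matrix representation `ρ : R →+* M_N(ℚ)` and `ρ`-stable `ℤ`-lattices `Λ ≤ L′ ≤ ℚ^N` with `ρ(𝔭)L′ ⊆ Λ`, `[L′ : Λ] = q²`)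
  **`natCard_stableLattice_of_relIndex_eq_sq`** — the `ρ`-stable `Λ ≤ H ≤ L′` with `[H : Λ] = q` number `q + 1` (§3 on `L′ ⁄ Λ`, `R` acting through `ρ`);
  **`exists_eq_of_injective_stableLattice`** — an injective `q + 1`-family of them is ALL of them (the rational-lattice currency of the Hecke-roof kernel laws).

## References
* [ShimuraIATAF1971] G. Shimura, *Introduction to the Arithmetic Theory of Automorphic Functions* (1971), §3.2 Lemma 3.23 (the `q + 1` right cosets ↔ lines).
* [DiamondShurman2005] F. Diamond, J. Shurman, *A First Course in Modular Forms* (2005), §5.2 (the double coset of `diag(1, p)` and the `p + 1` sublattices of index `p`).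
* [Milne2005ShimuraVarieties] J. S. Milne, *Introduction to Shimura varieties* (2005), §6 p. 75 («`V/Λ ≅ V(𝔸_f)/Λ̂`»: lattice neighbours as subgroups of torsion).
* [LidlNiederreiter1997] R. Lidl, H. Niederreiter, *Finite Fields* (1997), Ch. 2 §1 Lemma 2.1, Theorem 2.2.  [DummitFoote2004] D. Dummit, R. Foote, *Abstract Algebra* (2004), §10.1.

#harness_tags linear_algebra.finite_fields, number_theory.hecke_operators
-/

set_option autoImplicit false

noncomputable section

open Module

namespace Literature.LinearAlgebra

/-! ### §1 Additive subgroups stable under the scalars are the submodules (any ring, any module) -/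

section Stable

variable {S W : Type*} [Ring S] [AddCommGroup W] [Module S W]

/-- An additive subgroup stable under the scalars is the underlying subgroup of a submodule, and conversely (the definition of a submodule).
[cite: DummitFoote2004, §10.1 Definition (submodule) and Prop. 1 (the submodule criterion)] -/
theorem exists_submodule_toAddSubgroup_eq_iff (H : AddSubgroup W) :
    (∃ Y : Submodule S W, Y.toAddSubgroup = H) ↔ ∀ (c : S) (x : W), x ∈ H → c • x ∈ H := by
  constructor
  · rintro ⟨Y, rfl⟩ c x hx
    exact Y.smul_mem c hx
  · intro h
    exact ⟨{ H with smul_mem' := fun c x hx => h c x hx }, rfl⟩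

/-- **Stable additive subgroups ↔ submodules, with any side condition on the cardinality of the carrier**: the subtype of `S`-stable additive subgroups `H` of `W`
with `P (Nat.card H)` has the same cardinality as the subtype of submodules `Y` with `P (Nat.card Y)` (the maps `H ↦ ⟨H, ·⟩`, `Y ↦ Y.toAddSubgroup` are inverse
bijections; the carriers, hence their cardinalities, agree). [cite: DummitFoote2004, §10.1 Definition (submodule) and Prop. 1 (the submodule criterion)] -/
theorem natCard_stableAddSubgroup_eq_natCard_submodule (P : ℕ → Prop) :
    Nat.card {H : AddSubgroup W // (∀ (c : S) (x : W), x ∈ H → c • x ∈ H) ∧ P (Nat.card H)} =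
      Nat.card {Y : Submodule S W // P (Nat.card Y)} := by
  refine Nat.card_congr
    { toFun := fun H => ⟨{ H.1 with smul_mem' := fun c x hx => H.2.1 c x hx }, H.2.2⟩
      invFun := fun Y => ⟨Y.1.toAddSubgroup, fun c x hx => Y.1.smul_mem c hx, Y.2⟩
      left_inv := fun _ => rfl
      right_inv := fun _ => rfl }

end Stable

/-! ### §2 Vector spaces over a finite field: `Nat.card W = q²` ⇒ the stable subgroups of order `q` are the `q + 1` lines -/

section Field

variable {k W : Type*} [Field k] [Finite k] [AddCommGroup W] [Module k W]

omit [AddCommGroup W] [Module k W] in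
/-- `Nat.card W = q ^ n` (`q = Nat.card k ≥ 2`) forces `W` finite. [folklore] -/
private theorem finite_of_natCard_eq_natCard_pow {n : ℕ} (hW : Nat.card W = Nat.card k ^ n) : Finite W := by
  refine Nat.finite_of_card_ne_zero ?_
  rw [hW]
  exact pow_ne_zero _ (Nat.pos_iff_ne_zero.1 (lt_trans Nat.zero_lt_one Finite.one_lt_card))

/-- **`Nat.card W = q ^ n ⇒ finrank k W = n`** (`Nat.card W = q ^ finrank` for a finite-dimensional space over the finite field `k`, Mathlib
`Module.natCard_eq_pow_finrank`, and `q ≥ 2`). [cite: LidlNiederreiter1997, Ch. 2 §1, Lemma 2.1 and Theorem 2.2 (a space of dimension `m` over `𝔽_q` has `q^m` elements)] -/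
theorem finrank_eq_of_natCard_eq_natCard_pow {n : ℕ} (hW : Nat.card W = Nat.card k ^ n) : finrank k W = n := by
  haveI : Finite W := finite_of_natCard_eq_natCard_pow hW
  haveI : Module.Finite k W := Module.Finite.of_finite
  have h : Nat.card k ^ finrank k W = Nat.card k ^ n := by rw [← Module.natCard_eq_pow_finrank, hW]
  exact Nat.pow_right_injective Finite.one_lt_card h

/-- For a submodule `Y` of a finite `W`: `Nat.card Y = q ^ m ↔ finrank k Y = m`.
[cite: LidlNiederreiter1997, Ch. 2 §1, Lemma 2.1 and Theorem 2.2 (a space of dimension `m` over `𝔽_q` has `q^m` elements)] -/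
theorem natCard_submodule_eq_iff_finrank_eq [Finite W] (Y : Submodule k W) (m : ℕ) :
    Nat.card Y = Nat.card k ^ m ↔ finrank k Y = m := by
  haveI : Module.Finite k Y := Module.Finite.of_finite
  rw [Module.natCard_eq_pow_finrank (K := k) (V := Y)]
  exact ⟨fun h => Nat.pow_right_injective Finite.one_lt_card h, fun h => by rw [h]⟩

/-- **A `q²`-element space over `𝔽_q` has exactly `q + 1` stable subgroups of order `q`** — they are its lines (★ `card_submodule_codim_one_of_finrank_eq_two`).
[cite: ShimuraIATAF1971, §3.2 Lemma 3.23] [cite: DiamondShurman2005, §5.2] -/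
theorem natCard_stableAddSubgroup_of_natCard_eq_sq (hW : Nat.card W = Nat.card k ^ 2) :
    Nat.card {H : AddSubgroup W // (∀ (c : k) (x : W), x ∈ H → c • x ∈ H) ∧ Nat.card H = Nat.card k} = Nat.card k + 1 := by
  haveI : Finite W := finite_of_natCard_eq_natCard_pow hW
  haveI : Module.Finite k W := Module.Finite.of_finite
  have h2 : finrank k W = 2 := finrank_eq_of_natCard_eq_natCard_pow hW
  rw [natCard_stableAddSubgroup_eq_natCard_submodule (S := k) (fun n => n = Nat.card k),
    ← Literature.NumberTheory.Automorphic.card_submodule_codim_one_of_finrank_eq_two h2]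
  refine Nat.card_congr (Equiv.subtypeEquivRight fun Y => ?_)
  rw [h2, show Nat.card k = Nat.card k ^ 1 from (pow_one _).symm, natCard_submodule_eq_iff_finrank_eq Y 1]
  constructor
  · intro h
    exact ⟨bot_le, by rw [h]⟩
  · rintro ⟨-, h⟩
    omega

end Field

/-! ### §3 Modules over a commutative ring killed by an ideal with finite residue field -/

section Ring

variable {R W : Type*} [CommRing R] (𝔭 : Ideal R) [𝔭.IsMaximal] [Finite (R ⧸ 𝔭)] [AddCommGroup W] [Module R W]

/-- **THE HEAD.**  Let `𝔭` be an ideal of the commutative ring `R` with FINITE RESIDUE FIELD `R ⧸ 𝔭` of cardinality `q`, and `W` an `R`-module KILLED BY `𝔭` with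
`Nat.card W = q²`.  Then the `R`-stable additive subgroups of `W` of order `q` number exactly `q + 1`: `R` acts through the field `R ⧸ 𝔭` (Mathlib
`Module.IsTorsionBySet.module`), `R`-stable = `R ⧸ 𝔭`-stable, and §2 applies.  (The (L-c′) target: `W := 𝔭_{c•w}⁻¹L̂ ∕ L̂`, `q = Nat.card (𝓞_F ⧸ 𝔭_{c•w})`.)
[cite: ShimuraIATAF1971, §3.2 Lemma 3.23] [cite: DiamondShurman2005, §5.2] [cite: Milne2005ShimuraVarieties, §6 p. 75] -/
theorem natCard_stableAddSubgroup_of_isTorsionBySet (hW𝔭 : ∀ a ∈ 𝔭, ∀ w : W, a • w = 0)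
    (hW : Nat.card W = Nat.card (R ⧸ 𝔭) ^ 2) :
    Nat.card {H : AddSubgroup W // (∀ (r : R) (x : W), x ∈ H → r • x ∈ H) ∧ Nat.card H = Nat.card (R ⧸ 𝔭)} = Nat.card (R ⧸ 𝔭) + 1 := by
  letI : Field (R ⧸ 𝔭) := Ideal.Quotient.field 𝔭
  have hT : Module.IsTorsionBySet R W (𝔭 : Set R) := fun x a => hW𝔭 a a.2 x
  letI : Module (R ⧸ 𝔭) W := hT.module
  rw [← natCard_stableAddSubgroup_of_natCard_eq_sq (k := R ⧸ 𝔭) hW]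
  refine Nat.card_congr (Equiv.subtypeEquivRight fun H => and_congr_left fun _ => ?_)
  constructor
  · intro h c x hx
    obtain ⟨r, rfl⟩ := Ideal.Quotient.mk_surjective c
    rw [Module.IsTorsionBySet.mk_smul hT]
    exact h r x hx
  · intro h r x hx
    rw [← Module.IsTorsionBySet.mk_smul hT]
    exact h _ x hx

/-- The subtype of `R`-stable order-`q` subgroups is finite (it has `q + 1` elements). [cite: ShimuraIATAF1971, §3.2 Lemma 3.23] [cite: DiamondShurman2005, §5.2] -/
theorem finite_stableAddSubgroup_of_isTorsionBySet (hW𝔭 : ∀ a ∈ 𝔭, ∀ w : W, a • w = 0)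
    (hW : Nat.card W = Nat.card (R ⧸ 𝔭) ^ 2) :
    Finite {H : AddSubgroup W // (∀ (r : R) (x : W), x ∈ H → r • x ∈ H) ∧ Nat.card H = Nat.card (R ⧸ 𝔭)} := by
  refine Nat.finite_of_card_ne_zero ?_
  rw [natCard_stableAddSubgroup_of_isTorsionBySet 𝔭 hW𝔭 hW]
  exact Nat.succ_ne_zero _

/-- **EXHAUSTION BY COUNTING** (the (L-c′) call): an INJECTIVE map into the `R`-stable order-`q` subgroups of `W` from a type with `q + 1` elements — e.g. the Hecke
coset space `K t₁ K ∕ K` at a split place with `gK ↦ H(g)` — is a BIJECTION; in particular every stable subgroup of order `q` is in its image.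
[cite: ShimuraIATAF1971, §3.2 Lemma 3.23] [cite: DiamondShurman2005, §5.2] -/
theorem bijective_of_injective_to_stableAddSubgroup (hW𝔭 : ∀ a ∈ 𝔭, ∀ w : W, a • w = 0)
    (hW : Nat.card W = Nat.card (R ⧸ 𝔭) ^ 2) {ι : Type*} (hι : Nat.card ι = Nat.card (R ⧸ 𝔭) + 1)
    (f : ι → {H : AddSubgroup W // (∀ (r : R) (x : W), x ∈ H → r • x ∈ H) ∧ Nat.card H = Nat.card (R ⧸ 𝔭)})
    (hf : Function.Injective f) : Function.Bijective f := by
  haveI := finite_stableAddSubgroup_of_isTorsionBySet 𝔭 hW𝔭 hW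
  exact hf.bijective_of_nat_card_le (by rw [natCard_stableAddSubgroup_of_isTorsionBySet 𝔭 hW𝔭 hW, hι])

end Ring

/-! ### §4 (ED. 2) LATTICE FORM: `ρ`-stable intermediate lattices `Λ ≤ H ≤ L′` of index `q` in a rational space, for a matrix representation `ρ` -/

section Lattice

open _root_.Matrix

variable {R : Type*} [CommRing R] {N : Type*} [Fintype N] [DecidableEq N]

omit [Fintype N] [DecidableEq N] in
/-- Cardinality bookkeeping: for a `ℤ`-submodule `P` of `L′`, the image of `P` in `L′ ⁄ Λ′` (`Λ′ = Λ ∩ L′`) has `[P : Λ]` elements (`P` read in the ambient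
space; Mathlib `AddSubgroup.relIndex_ker`, `relIndex_comap`). [folklore] -/
private theorem natCard_map_mkQ_eq_relIndex (Λ L' : Submodule ℤ (N → ℚ)) (P : Submodule ℤ L') :
    Nat.card ↥(P.map (Λ.comap L'.subtype).mkQ) =
      Λ.toAddSubgroup.relIndex (P.map L'.subtype).toAddSubgroup := by
  have hker : ((Λ.comap L'.subtype).mkQ : L' →+ L' ⧸ Λ.comap L'.subtype).ker =
      Λ.toAddSubgroup.comap (L'.subtype : L' →+ (N → ℚ)) :=
    AddSubgroup.ext fun v => Submodule.Quotient.mk_eq_zero _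
  have h := AddSubgroup.relIndex_ker P.toAddSubgroup ((Λ.comap L'.subtype).mkQ : L' →+ L' ⧸ Λ.comap L'.subtype)
  rw [hker, AddSubgroup.relIndex_comap, ← Submodule.map_toAddSubgroup] at h
  rw [h]
  rfl

/-- **LATTICE FORM OF THE COUNT.**  Let `ρ : R →+* M_N(ℚ)` be a matrix representation, `Λ ≤ L′` two `ρ`-stable `ℤ`-lattices (any `ℤ`-submodules of `ℚ^N`) with
`ρ(𝔭) L′ ⊆ Λ` for an ideal `𝔭` with finite residue FIELD `R ⧸ 𝔭` of cardinality `q`, and `[L′ : Λ] = q²` (Mathlib `AddSubgroup.relIndex`).  Then the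
`ρ`-STABLE INTERMEDIATE LATTICES `Λ ≤ H ≤ L′` with `[H : Λ] = q` number exactly `q + 1` — §3 applied to `W := L′ ⁄ Λ` with the `R`-module structure induced by `ρ`
(the (L-c′) target in the rational-lattice currency of the Hecke-roof kernel laws: `Λ = Λ_a`, `L′ = 𝔭_{c•w}⁻¹Λ_a := ⨅_{π̄ ∈ 𝔭_{c•w}} ρ(π̄)⁻¹Λ_a`).
[cite: ShimuraIATAF1971, §3.2 Lemma 3.23] [cite: DiamondShurman2005, §5.2] [cite: Milne2005ShimuraVarieties, §6 p. 75] -/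
theorem natCard_stableLattice_of_relIndex_eq_sq (𝔭 : Ideal R) [𝔭.IsMaximal] [Finite (R ⧸ 𝔭)]
    (ρ : R →+* Matrix N N ℚ) (Λ L' : Submodule ℤ (N → ℚ)) (hΛL : Λ ≤ L')
    (hΛ : ∀ b, ∀ v ∈ Λ, ρ b *ᵥ v ∈ Λ) (hL' : ∀ b, ∀ v ∈ L', ρ b *ᵥ v ∈ L')
    (h𝔭 : ∀ b ∈ 𝔭, ∀ v ∈ L', ρ b *ᵥ v ∈ Λ)
    (hidx : Λ.toAddSubgroup.relIndex L'.toAddSubgroup = Nat.card (R ⧸ 𝔭) ^ 2) :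
    Nat.card {H : Submodule ℤ (N → ℚ) // Λ ≤ H ∧ H ≤ L' ∧ (∀ b, ∀ v ∈ H, ρ b *ᵥ v ∈ H) ∧
      Λ.toAddSubgroup.relIndex H.toAddSubgroup = Nat.card (R ⧸ 𝔭)} = Nat.card (R ⧸ 𝔭) + 1 := by
  -- the action of `R` through `ρ` on `L′` (`v ↦ ρ b *ᵥ v`) and on `W := L′ ⁄ Λ′`, `Λ′ = Λ ∩ L′` read inside `L′`
  let act : R → (L' →ₗ[ℤ] L') := fun b => (((ρ b).mulVecLin).restrictScalars ℤ).restrict fun v hv => hL' b v hv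
  have act_coe : ∀ (b : R) (v : L'), ((act b v : L') : N → ℚ) = ρ b *ᵥ (v : N → ℚ) := fun _ _ => rfl
  have hstab : ∀ b : R, Λ.comap L'.subtype ≤ (Λ.comap L'.subtype).comap (act b) := fun b v hv => by
    rw [Submodule.mem_comap, Submodule.subtype_apply] at hv
    rw [Submodule.mem_comap, Submodule.mem_comap, Submodule.subtype_apply, act_coe]
    exact hΛ b _ hv
  let actW : R → Module.End ℤ (L' ⧸ Λ.comap L'.subtype) := fun b =>
    (Λ.comap L'.subtype).mapQ (Λ.comap L'.subtype) (act b) (hstab b)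
  have actW_mk : ∀ (b : R) (v : L'),
      actW b (Submodule.Quotient.mk v) = Submodule.Quotient.mk (act b v) := fun _ _ => rfl
  have act_ext : ∀ {b : R} {v w : L'}, ((act b v : L') : N → ℚ) = (w : N → ℚ) → act b v = w := fun h => Subtype.ext h
  let φ : R →+* Module.End ℤ (L' ⧸ Λ.comap L'.subtype) :=
    { toFun := actW
      map_one' := by
        refine LinearMap.ext fun x => ?_
        obtain ⟨v, rfl⟩ := Submodule.Quotient.mk_surjective (Λ.comap L'.subtype) x
        have h1 : act 1 v = v := act_ext (by rw [act_coe, map_one, Matrix.one_mulVec])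
        rw [actW_mk, h1]
        rfl
      map_mul' := fun a b => by
        refine LinearMap.ext fun x => ?_
        obtain ⟨v, rfl⟩ := Submodule.Quotient.mk_surjective (Λ.comap L'.subtype) x
        have h2 : act (a * b) v = act a (act b v) :=
          act_ext (by rw [act_coe, act_coe, act_coe, map_mul, Matrix.mulVec_mulVec])
        rw [Module.End.mul_apply, actW_mk, actW_mk, actW_mk, h2]
      map_zero' := by
        refine LinearMap.ext fun x => ?_
        obtain ⟨v, rfl⟩ := Submodule.Quotient.mk_surjective (Λ.comap L'.subtype) x
        have h0 : act 0 v = 0 := act_ext (by rw [act_coe, map_zero, Matrix.zero_mulVec, Submodule.coe_zero])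
        rw [actW_mk, LinearMap.zero_apply, h0, Submodule.Quotient.mk_zero]
      map_add' := fun a b => by
        refine LinearMap.ext fun x => ?_
        obtain ⟨v, rfl⟩ := Submodule.Quotient.mk_surjective (Λ.comap L'.subtype) x
        have h3 : act (a + b) v = act a v + act b v :=
          act_ext (by rw [act_coe, Submodule.coe_add, act_coe, act_coe, map_add, Matrix.add_mulVec])
        rw [LinearMap.add_apply, actW_mk, actW_mk, actW_mk, ← Submodule.Quotient.mk_add, h3] }
  letI : Module R (L' ⧸ Λ.comap L'.subtype) := Module.compHom (L' ⧸ Λ.comap L'.subtype) φ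
  have hsmul : ∀ (b : R) (v : L'),
      b • (Submodule.Quotient.mk v : L' ⧸ Λ.comap L'.subtype) = Submodule.Quotient.mk (act b v) := fun b v => actW_mk b v
  -- an additive subgroup of `W` as a `ℤ`-submodule (same carrier)
  let toSub : AddSubgroup (L' ⧸ Λ.comap L'.subtype) → Submodule ℤ (L' ⧸ Λ.comap L'.subtype) := fun B =>
    { carrier := B
      add_mem' := B.add_mem
      zero_mem' := B.zero_mem
      smul_mem' := fun n x hx => by
        induction n using Int.induction_on with
        | zero => rw [zero_smul]; exact B.zero_mem
        | succ k ih => rw [add_smul, one_smul]; exact B.add_mem ih hx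
        | pred k ih => rw [sub_smul, one_smul]; exact B.sub_mem ih hx }
  have toSub_toAddSubgroup : ∀ B, (toSub B).toAddSubgroup = B := fun B => AddSubgroup.ext fun _ => Iff.rfl
  have toSub_toAddSubgroup' : ∀ Y : Submodule ℤ (L' ⧸ Λ.comap L'.subtype), toSub Y.toAddSubgroup = Y :=
    fun Y => Submodule.ext fun _ => Iff.rfl
  have hΛ'P : ∀ {H : Submodule ℤ (N → ℚ)}, Λ ≤ H → Λ.comap L'.subtype ≤ H.comap L'.subtype :=
    fun h v hv => by rw [Submodule.mem_comap] at hv ⊢; exact h hv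
  -- `𝔭` kills `W`
  have hW𝔭 : ∀ a ∈ 𝔭, ∀ w : L' ⧸ Λ.comap L'.subtype, a • w = 0 := by
    intro a ha w
    obtain ⟨v, rfl⟩ := Submodule.Quotient.mk_surjective (Λ.comap L'.subtype) w
    rw [hsmul, Submodule.Quotient.mk_eq_zero, Submodule.mem_comap, Submodule.subtype_apply, act_coe]
    exact h𝔭 a ha _ v.2
  -- `Nat.card W = [L′ : Λ] = q²`
  have hW : Nat.card (L' ⧸ Λ.comap L'.subtype) = Nat.card (R ⧸ 𝔭) ^ 2 := by
    rw [← hidx]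
    have h := natCard_map_mkQ_eq_relIndex Λ L' ⊤
    rw [Submodule.map_top, Submodule.range_mkQ, Submodule.map_top, Submodule.range_subtype] at h
    rw [← h]
    exact Nat.card_congr (Equiv.Set.univ _).symm
  rw [← natCard_stableAddSubgroup_of_isTorsionBySet 𝔭 hW𝔭 hW]
  -- the bijection `H ↦ (H ∩ L′) ⁄ Λ′`, `B ↦ preimage of B in L′`
  refine Nat.card_congr
    { toFun := fun H => ⟨((H.1.comap L'.subtype).map (Λ.comap L'.subtype).mkQ).toAddSubgroup, ?_, ?_⟩
      invFun := fun B => ⟨((toSub B.1).comap (Λ.comap L'.subtype).mkQ).map L'.subtype, ?_, ?_, ?_, ?_⟩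
      left_inv := fun H => ?_
      right_inv := fun B => ?_ }
  · -- `R`-stability of the image
    rintro b x hx
    rw [Submodule.mem_toAddSubgroup] at hx ⊢
    obtain ⟨v, hv, rfl⟩ := Submodule.mem_map.1 hx
    refine Submodule.mem_map.2 ⟨act b v, ?_, (hsmul b v).symm⟩
    rw [Submodule.mem_comap, Submodule.subtype_apply] at hv ⊢
    rw [act_coe]
    exact H.2.2.2.1 b _ hv
  · -- its cardinality `[H : Λ]`
    have h := natCard_map_mkQ_eq_relIndex Λ L' (H.1.comap L'.subtype)
    rw [Submodule.map_comap_subtype, inf_eq_right.2 H.2.2.1] at h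
    exact h.trans H.2.2.2.2
  · -- `Λ ≤` preimage
    intro v hv
    refine Submodule.mem_map.2 ⟨⟨v, hΛL hv⟩, ?_, rfl⟩
    rw [Submodule.mem_comap, Submodule.mkQ_apply, (Submodule.Quotient.mk_eq_zero _).2 (by rw [Submodule.mem_comap]; exact hv)]
    exact Submodule.zero_mem _
  · -- preimage `≤ L′`
    exact Submodule.map_subtype_le L' _
  · -- `ρ`-stability of the preimage
    intro b v hv
    obtain ⟨x, hx, rfl⟩ := Submodule.mem_map.1 hv
    refine Submodule.mem_map.2 ⟨act b x, ?_, rfl⟩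
    rw [Submodule.mem_comap, Submodule.mkQ_apply] at hx ⊢
    rw [← hsmul]
    exact B.2.1 b _ hx
  · -- index of the preimage `= Nat.card B`
    have h := natCard_map_mkQ_eq_relIndex Λ L' ((toSub B.1).comap (Λ.comap L'.subtype).mkQ)
    rw [Submodule.map_comap_eq_of_surjective (Submodule.mkQ_surjective _)] at h
    exact h.symm.trans B.2.2
  · -- left inverse: preimage of the image is `H`
    apply Subtype.ext
    change ((toSub ((H.1.comap L'.subtype).map (Λ.comap L'.subtype).mkQ).toAddSubgroup).comap
      (Λ.comap L'.subtype).mkQ).map L'.subtype = H.1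
    rw [toSub_toAddSubgroup', Submodule.comap_map_mkQ, sup_eq_right.2 (hΛ'P H.2.1), Submodule.map_comap_subtype,
      inf_eq_right.2 H.2.2.1]
  · -- right inverse: image of the preimage is `B`
    apply Subtype.ext
    change ((((toSub B.1).comap (Λ.comap L'.subtype).mkQ).map L'.subtype).comap L'.subtype |>.map
      (Λ.comap L'.subtype).mkQ).toAddSubgroup = B.1
    rw [Submodule.comap_map_eq_of_injective (Submodule.injective_subtype L'), Submodule.map_comap_eq_of_surjective (Submodule.mkQ_surjective _),
      toSub_toAddSubgroup]

/-- **EXHAUSTION BY COUNTING, LATTICE FORM** (the (L-c′) call in lattice currency): with the data of `natCard_stableLattice_of_relIndex_eq_sq`, an INJECTIVE family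
`H_i` (`i : ι`, `Nat.card ι = q + 1`) of `ρ`-stable intermediate lattices of index `q` EXHAUSTS them: every `ρ`-stable `Λ ≤ H ≤ L′` with `[H : Λ] = q` is an `H_i`.
[cite: ShimuraIATAF1971, §3.2 Lemma 3.23] [cite: DiamondShurman2005, §5.2] -/
theorem exists_eq_of_injective_stableLattice (𝔭 : Ideal R) [𝔭.IsMaximal] [Finite (R ⧸ 𝔭)]
    (ρ : R →+* Matrix N N ℚ) (Λ L' : Submodule ℤ (N → ℚ)) (hΛL : Λ ≤ L')
    (hΛ : ∀ b, ∀ v ∈ Λ, ρ b *ᵥ v ∈ Λ) (hL' : ∀ b, ∀ v ∈ L', ρ b *ᵥ v ∈ L')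
    (h𝔭 : ∀ b ∈ 𝔭, ∀ v ∈ L', ρ b *ᵥ v ∈ Λ)
    (hidx : Λ.toAddSubgroup.relIndex L'.toAddSubgroup = Nat.card (R ⧸ 𝔭) ^ 2)
    {ι : Type*} (hι : Nat.card ι = Nat.card (R ⧸ 𝔭) + 1) (Hfam : ι → Submodule ℤ (N → ℚ)) (hinj : Function.Injective Hfam)
    (hfam : ∀ i, Λ ≤ Hfam i ∧ Hfam i ≤ L' ∧ (∀ b, ∀ v ∈ Hfam i, ρ b *ᵥ v ∈ Hfam i) ∧
      Λ.toAddSubgroup.relIndex (Hfam i).toAddSubgroup = Nat.card (R ⧸ 𝔭))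
    (H : Submodule ℤ (N → ℚ)) (hH : Λ ≤ H ∧ H ≤ L' ∧ (∀ b, ∀ v ∈ H, ρ b *ᵥ v ∈ H) ∧
      Λ.toAddSubgroup.relIndex H.toAddSubgroup = Nat.card (R ⧸ 𝔭)) :
    ∃ i, Hfam i = H := by
  let f : ι → {H : Submodule ℤ (N → ℚ) // Λ ≤ H ∧ H ≤ L' ∧ (∀ b, ∀ v ∈ H, ρ b *ᵥ v ∈ H) ∧
      Λ.toAddSubgroup.relIndex H.toAddSubgroup = Nat.card (R ⧸ 𝔭)} := fun i => ⟨Hfam i, hfam i⟩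
  have hf : Function.Injective f := fun i j h => hinj (congrArg Subtype.val h)
  haveI : Finite {H : Submodule ℤ (N → ℚ) // Λ ≤ H ∧ H ≤ L' ∧ (∀ b, ∀ v ∈ H, ρ b *ᵥ v ∈ H) ∧
      Λ.toAddSubgroup.relIndex H.toAddSubgroup = Nat.card (R ⧸ 𝔭)} := by
    refine Nat.finite_of_card_ne_zero ?_
    rw [natCard_stableLattice_of_relIndex_eq_sq 𝔭 ρ Λ L' hΛL hΛ hL' h𝔭 hidx]
    exact Nat.succ_ne_zero _
  have hbij : Function.Bijective f :=
    hf.bijective_of_nat_card_le (by rw [natCard_stableLattice_of_relIndex_eq_sq 𝔭 ρ Λ L' hΛL hΛ hL' h𝔭 hidx, hι])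
  obtain ⟨i, hi⟩ := hbij.2 ⟨H, hH⟩
  exact ⟨i, congrArg Subtype.val hi⟩

end Lattice

end Literature.LinearAlgebra

end
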